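import Literature.Analysis.ODE.SlowColumnSlaving
import HarnessLib

/-!
# Slaving of the fast components to the slow mode — consumer form on an integer window
# (three-term ladders `v_J' = −Λ(d_J v_J + g(t)(s_{J−1} v_{J−1} − s_J v_{J+1}))`, `J ∈ W ⊂ ℤ`)

Topic `Literature/Analysis/ODE` (namespace `Literature.Analysis.ODE.IntWindowLadder`). Everything here is PROVED
(no definition, no named fact): this file only SPECIALISES `Literature.Analysis.ODE.SlowColumnSlaving` (the
one-column Chang / Hartman–Wintner Riccati decoupling [cite: KokotovicBensoussanBlankenship1987, Kokotović §2
(2.29), Thm 2.3] [cite: Eastham1989, §1.5 Thm 1.5.1]) to the shape in which Fourier ladders of shear-flow cell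
problems arrive: a sequence-valued curve `v : ℝ → ℤ → ℂ` supported in a finite window `W ∋ −1, 0, 1` (Dirichlet /
Galerkin truncation: `v t J = 0` off `W`), real links `s : ℤ → ℝ` with `|s J| ≤ 1` (the three-term recursion of
the Kolmogorov flow [cite: MeshalkinSinai1961, pp. 1700–1705]; `s ≡ 1` for a scalar ladder, Leray cosines for the
in-plane block of a solenoidal one), real diagonal rates `d : ℤ → ℝ` with the slow index `0` separated by a gap
`d J ≥ d 0 + Δ` (`J ∈ W ∖ {0}`), a rate `Λ > 0`, a real coupling `|g t| ≤ g_T` (sign and time-dependence free),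
and derivatives `HasDerivWithinAt … (Icc t₀ t₁) t` coordinate-wise at every `t ∈ [t₀, t₁]`.

With `γ² = s 0² + s (−1)²` (coupling of the slow mode to its two neighbours) and the Schur bound `σ = 2`:

* `cone_intWindow` — invariant slow cone: `Σ_{J ∈ W∖0} ‖v_J(t)‖² ≤ R² ‖v_0(t)‖²`, `v_0(t) ≠ 0`, for
  `g_T γ (1 + R²) < Δ R` and a strict start;
* `abs_log_sub_le_intWindow` — crude two-sided law `|log ‖v_0(t)‖² − log ‖v_0(t₀)‖² + 2Λ d_0 (t − t₀)| ≤ 2Λ g_T γ R (t − t₀)`;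
* `column_law_intWindow` — **the slot-column law to second order**: for the column datum (`v_J(t₀) = 0`, `J ≠ 0`),
  with the two real Duhamel responses `j_{±1}` of `g` at the rates `Λ(d_{±1} − d_0)` (`j' = g − Λ(d_{±1} − d_0) j`,
  `j(t₀) = 0`) and any primitive `Φ` of `Λ g (s 0² j₁ + s(−1)² j₋₁)`:
  `|log ‖v_0(t)‖² − log ‖v_0(t₀)‖² + 2Λ d_0 (t − t₀) + 2Λ (Φ t − Φ t₀)| ≤ 2Λ g_T γ Q (t − t₀)`,
  `Q = g_T R (2 + γ R)/Δ` — uniformly in the window `W`;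
* `offCone_intWindow`, `column_remainder_intWindow` — the other columns (two-time-scale amplitude bounds off the
  cone) and the first-order profile of the column's fast entries;
* `real_intWindow`, `column_slow_eq_norm_intWindow` — real data stay real; for the column datum with a real positive
  slow entry, `v_0(t) = ‖v_0(t)‖`: the slot multiplier carries no phase;
* `eq_of_eq_init_intWindow`, `eq_add_intWindow`, `split_intWindow` — uniqueness, superposition, and the split of a
  general datum into its column and its fast part (slow feed `≤ g_Tγ/Δ`, fast relaxation at the gap rate);
* `eq_smul_intWindow`, `column_slow_phase_intWindow` — scaling, and the phase-free form of the slot multiplier for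
  ANY complex slow datum: `v_0(t) = (‖v_0(t)‖/‖v_0(t₀)‖)·v_0(t₀)`.
-/

noncomputable section

namespace Literature.Analysis.ODE

namespace IntWindowLadder

open Set Finset Complex Filter
open scoped BigOperators ComplexConjugate Topology

/-! ## §0 The link matrix on `↥W` (written inline; no definition) and its bookkeeping -/

/-- Action of the link matrix on a sequence vanishing off `W`: `Σ_{K∈W} S_{JK} w_K = s_{J−1} w_{J−1} − s_J w_{J+1}`.
[folklore] -/
private theorem sum_link_apply (W : Finset ℤ) (s : ℤ → ℝ) {w : ℤ → ℂ} (hw : ∀ K, K ∉ W → w K = 0) (J : ℤ) :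
    ∑ K : ↥W, ((if (K : ℤ) = J - 1 then ((s (J - 1) : ℝ) : ℂ) else 0) +
        (if (K : ℤ) = J + 1 then -((s J : ℝ) : ℂ) else 0)) * w K =
      (s (J - 1) : ℂ) * w (J - 1) - (s J : ℂ) * w (J + 1) := by
  classical
  rw [show (∑ K : ↥W, ((if (K : ℤ) = J - 1 then ((s (J - 1) : ℝ) : ℂ) else 0) +
        (if (K : ℤ) = J + 1 then -((s J : ℝ) : ℂ) else 0)) * w K) =
      ∑ K ∈ W, ((if K = J - 1 then ((s (J - 1) : ℝ) : ℂ) else 0) + (if K = J + 1 then -((s J : ℝ) : ℂ) else 0)) * w K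
    from (Finset.sum_coe_sort W (fun K => ((if K = J - 1 then ((s (J - 1) : ℝ) : ℂ) else 0) +
      (if K = J + 1 then -((s J : ℝ) : ℂ) else 0)) * w K))]
  simp_rw [add_mul, Finset.sum_add_distrib, ite_mul, zero_mul]
  rw [Finset.sum_ite_eq' W (J - 1), Finset.sum_ite_eq' W (J + 1)]
  have e1 : (if J - 1 ∈ W then ((s (J - 1) : ℝ) : ℂ) * w (J - 1) else 0) = (s (J - 1) : ℂ) * w (J - 1) := by
    split_ifs with h
    · rfl
    · rw [hw _ h, mul_zero]
  have e2 : (if J + 1 ∈ W then -((s J : ℝ) : ℂ) * w (J + 1) else 0) = -((s J : ℂ) * w (J + 1)) := by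
    split_ifs with h
    · rw [neg_mul]
    · rw [hw _ h, mul_zero, neg_zero]
  rw [e1, e2]
  ring

/-- The link matrix with real links is skew-Hermitian. [folklore] -/
private theorem link_skew (W : Finset ℤ) (s : ℤ → ℝ) (J K : ↥W) :
    ((if ((J : ↥W) : ℤ) = (K : ℤ) - 1 then ((s ((K : ℤ) - 1) : ℝ) : ℂ) else 0) +
        (if ((J : ↥W) : ℤ) = (K : ℤ) + 1 then -((s (K : ℤ) : ℝ) : ℂ) else 0)) =
      -conj ((if (K : ℤ) = (J : ℤ) - 1 then ((s ((J : ℤ) - 1) : ℝ) : ℂ) else 0) +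
        (if (K : ℤ) = (J : ℤ) + 1 then -((s (J : ℤ) : ℝ) : ℂ) else 0)) := by
  by_cases h1 : (J : ℤ) = (K : ℤ) - 1
  · have h2 : (K : ℤ) = (J : ℤ) + 1 := by omega
    have h3 : ¬ (J : ℤ) = (K : ℤ) + 1 := by omega
    have h4 : ¬ (K : ℤ) = (J : ℤ) - 1 := by omega
    rw [if_pos h1, if_neg h3, if_neg h4, if_pos h2, show (K : ℤ) - 1 = (J : ℤ) by omega]
    simp [Complex.conj_ofReal]
  · by_cases h3 : (J : ℤ) = (K : ℤ) + 1
    · have h4 : (K : ℤ) = (J : ℤ) - 1 := by omega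
      have h2 : ¬ (K : ℤ) = (J : ℤ) + 1 := by omega
      rw [if_neg h1, if_pos h3, if_pos h4, if_neg h2, show (J : ℤ) - 1 = (K : ℤ) by omega]
      simp [Complex.conj_ofReal]
    · have h2 : ¬ (K : ℤ) = (J : ℤ) + 1 := by omega
      have h4 : ¬ (K : ℤ) = (J : ℤ) - 1 := by omega
      rw [if_neg h1, if_neg h3, if_neg h4, if_neg h2]
      simp

/-- Re-indexing: a sum over `univ.erase o` in `↥W` (`o = ⟨0, _⟩`) is the sum over `W.erase 0`. [folklore] -/
private theorem sum_univ_erase_eq (W : Finset ℤ) (h0 : (0 : ℤ) ∈ W) (f : ℤ → ℝ) :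
    ∑ J ∈ (univ : Finset ↥W).erase ⟨0, h0⟩, f J = ∑ J ∈ W.erase 0, f J := by
  classical
  have h1 : ∑ J ∈ (univ : Finset ↥W).erase ⟨0, h0⟩, f J = ∑ J : ↥W, f J - f ((⟨0, h0⟩ : ↥W) : ℤ) :=
    Finset.sum_erase_eq_sub (Finset.mem_univ _)
  have h2 : ∑ J ∈ W.erase 0, f J = ∑ J ∈ W, f J - f 0 := Finset.sum_erase_eq_sub h0
  rw [h1, h2, Finset.sum_coe_sort W f]

/-- Complex-valued re-indexing. [folklore] -/
private theorem sum_univ_erase_eq' (W : Finset ℤ) (h0 : (0 : ℤ) ∈ W) (f : ℤ → ℂ) :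
    ∑ J ∈ (univ : Finset ↥W).erase ⟨0, h0⟩, f J = ∑ J ∈ W.erase 0, f J := by
  classical
  have h1 : ∑ J ∈ (univ : Finset ↥W).erase ⟨0, h0⟩, f J = ∑ J : ↥W, f J - f ((⟨0, h0⟩ : ↥W) : ℤ) :=
    Finset.sum_erase_eq_sub (Finset.mem_univ _)
  have h2 : ∑ J ∈ W.erase 0, f J = ∑ J ∈ W, f J - f 0 := Finset.sum_erase_eq_sub h0
  rw [h1, h2, Finset.sum_coe_sort W f]

/-- The slow row of the link matrix: `γ² = Σ_{K≠0} ‖S_{0K}‖² = s 0² + s(−1)²` when `±1 ∈ W`. [folklore] -/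
private theorem slowRow_norm_sq (W : Finset ℤ) (h0 : (0 : ℤ) ∈ W) (h1 : (1 : ℤ) ∈ W) (hm1 : (-1 : ℤ) ∈ W)
    (s : ℤ → ℝ) :
    ∑ K ∈ (univ : Finset ↥W).erase ⟨0, h0⟩,
        ‖(if (K : ℤ) = ((⟨0, h0⟩ : ↥W) : ℤ) - 1 then ((s (((⟨0, h0⟩ : ↥W) : ℤ) - 1) : ℝ) : ℂ) else 0) +
          (if (K : ℤ) = ((⟨0, h0⟩ : ↥W) : ℤ) + 1 then -((s ((⟨0, h0⟩ : ↥W) : ℤ) : ℝ) : ℂ) else 0)‖ ^ 2 =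
      s 0 ^ 2 + s (-1) ^ 2 := by
  classical
  rw [sum_univ_erase_eq W h0 (fun K => ‖(if K = ((⟨0, h0⟩ : ↥W) : ℤ) - 1 then
      ((s (((⟨0, h0⟩ : ↥W) : ℤ) - 1) : ℝ) : ℂ) else 0) +
      (if K = ((⟨0, h0⟩ : ↥W) : ℤ) + 1 then -((s ((⟨0, h0⟩ : ↥W) : ℤ) : ℝ) : ℂ) else 0)‖ ^ 2)]
  simp only [zero_sub, zero_add]
  -- split off `K = -1` and `K = 1`
  have hm1' : (-1 : ℤ) ∈ W.erase 0 := Finset.mem_erase.2 ⟨by norm_num, hm1⟩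
  have h1' : (1 : ℤ) ∈ (W.erase 0).erase (-1) := Finset.mem_erase.2 ⟨by norm_num, Finset.mem_erase.2 ⟨by norm_num, h1⟩⟩
  rw [← Finset.add_sum_erase _ _ hm1', ← Finset.add_sum_erase _ _ h1']
  have hrest : ∑ K ∈ ((W.erase 0).erase (-1)).erase 1,
      ‖(if K = -1 then ((s (-1) : ℝ) : ℂ) else 0) + (if K = 1 then -((s 0 : ℝ) : ℂ) else 0)‖ ^ 2 = 0 := by
    refine Finset.sum_eq_zero fun K hK => ?_
    have hK1 : K ≠ 1 := Finset.ne_of_mem_erase hK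
    have hK2 : K ≠ -1 := Finset.ne_of_mem_erase (Finset.mem_of_mem_erase hK)
    simp [hK1, hK2]
  rw [hrest]
  norm_num [Complex.norm_real, Real.norm_eq_abs, sq_abs]
  ring

/-- Row sums of the link matrix off the slow index: `Σ_{K≠0} ‖S_{JK}‖ ≤ 2` when `|s| ≤ 1` on `W`. [folklore] -/
private theorem link_rowSum_le_two (W : Finset ℤ) (h0 : (0 : ℤ) ∈ W) (s : ℤ → ℝ) (hs : ∀ J ∈ W, |s J| ≤ 1)
    (J : ↥W) :
    ∑ K ∈ (univ : Finset ↥W).erase ⟨0, h0⟩,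
        ‖(if (K : ℤ) = (J : ℤ) - 1 then ((s ((J : ℤ) - 1) : ℝ) : ℂ) else 0) +
          (if (K : ℤ) = (J : ℤ) + 1 then -((s (J : ℤ) : ℝ) : ℂ) else 0)‖ ≤ 2 := by
  classical
  calc ∑ K ∈ (univ : Finset ↥W).erase ⟨0, h0⟩,
        ‖(if (K : ℤ) = (J : ℤ) - 1 then ((s ((J : ℤ) - 1) : ℝ) : ℂ) else 0) +
          (if (K : ℤ) = (J : ℤ) + 1 then -((s (J : ℤ) : ℝ) : ℂ) else 0)‖
      ≤ ∑ K : ↥W, ‖(if (K : ℤ) = (J : ℤ) - 1 then ((s ((J : ℤ) - 1) : ℝ) : ℂ) else 0) +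
          (if (K : ℤ) = (J : ℤ) + 1 then -((s (J : ℤ) : ℝ) : ℂ) else 0)‖ :=
        Finset.sum_le_sum_of_subset_of_nonneg (Finset.erase_subset _ _) fun K _ _ => norm_nonneg _
    _ = ∑ K ∈ W, ‖(if K = (J : ℤ) - 1 then ((s ((J : ℤ) - 1) : ℝ) : ℂ) else 0) +
          (if K = (J : ℤ) + 1 then -((s (J : ℤ) : ℝ) : ℂ) else 0)‖ :=
        Finset.sum_coe_sort W (fun K => ‖(if K = (J : ℤ) - 1 then ((s ((J : ℤ) - 1) : ℝ) : ℂ) else 0) +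
          (if K = (J : ℤ) + 1 then -((s (J : ℤ) : ℝ) : ℂ) else 0)‖)
    _ ≤ ∑ K ∈ W, ((if K = (J : ℤ) - 1 then (1 : ℝ) else 0) + (if K = (J : ℤ) + 1 then 1 else 0)) := by
        refine Finset.sum_le_sum fun K hK => ?_
        by_cases hK1 : K = (J : ℤ) - 1
        · have hK2 : ¬ K = (J : ℤ) + 1 := by omega
          rw [if_pos hK1, if_neg hK2, if_pos hK1, if_neg hK2, add_zero, add_zero, Complex.norm_real,
            Real.norm_eq_abs]
          exact hs _ (hK1 ▸ hK)
        · by_cases hK2 : K = (J : ℤ) + 1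
          · rw [if_neg hK1, if_pos hK2, if_neg hK1, if_pos hK2, zero_add, zero_add, norm_neg, Complex.norm_real,
              Real.norm_eq_abs]
            exact hs _ J.2
          · rw [if_neg hK1, if_neg hK2, if_neg hK1, if_neg hK2, add_zero, norm_zero, add_zero]
    _ = (if (J : ℤ) - 1 ∈ W then (1 : ℝ) else 0) + (if (J : ℤ) + 1 ∈ W then 1 else 0) := by
        rw [Finset.sum_add_distrib, Finset.sum_ite_eq' W, Finset.sum_ite_eq' W]
    _ ≤ 1 + 1 := add_le_add (by split_ifs <;> norm_num) (by split_ifs <;> norm_num)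
    _ = 2 := by norm_num

/-- Weighted slow row: `Σ_{K≠0} ‖S_{0K}‖² f K = s 0² f 1 + s(−1)² f(−1)` when `±1 ∈ W`. [folklore] -/
private theorem slowRow_norm_sq_mul (W : Finset ℤ) (h0 : (0 : ℤ) ∈ W) (h1 : (1 : ℤ) ∈ W) (hm1 : (-1 : ℤ) ∈ W)
    (s : ℤ → ℝ) (f : ℤ → ℝ) :
    ∑ K ∈ (univ : Finset ↥W).erase ⟨0, h0⟩,
        ‖(if (K : ℤ) = ((⟨0, h0⟩ : ↥W) : ℤ) - 1 then ((s (((⟨0, h0⟩ : ↥W) : ℤ) - 1) : ℝ) : ℂ) else 0) +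
          (if (K : ℤ) = ((⟨0, h0⟩ : ↥W) : ℤ) + 1 then -((s ((⟨0, h0⟩ : ↥W) : ℤ) : ℝ) : ℂ) else 0)‖ ^ 2 * f K =
      s 0 ^ 2 * f 1 + s (-1) ^ 2 * f (-1) := by
  classical
  rw [sum_univ_erase_eq W h0 (fun K => ‖(if K = ((⟨0, h0⟩ : ↥W) : ℤ) - 1 then
      ((s (((⟨0, h0⟩ : ↥W) : ℤ) - 1) : ℝ) : ℂ) else 0) +
      (if K = ((⟨0, h0⟩ : ↥W) : ℤ) + 1 then -((s ((⟨0, h0⟩ : ↥W) : ℤ) : ℝ) : ℂ) else 0)‖ ^ 2 * f K)]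
  simp only [zero_sub, zero_add]
  have hm1' : (-1 : ℤ) ∈ W.erase 0 := Finset.mem_erase.2 ⟨by norm_num, hm1⟩
  have h1' : (1 : ℤ) ∈ (W.erase 0).erase (-1) :=
    Finset.mem_erase.2 ⟨by norm_num, Finset.mem_erase.2 ⟨by norm_num, h1⟩⟩
  rw [← Finset.add_sum_erase _ _ hm1', ← Finset.add_sum_erase _ _ h1']
  have hrest : ∑ K ∈ ((W.erase 0).erase (-1)).erase 1,
      ‖(if K = -1 then ((s (-1) : ℝ) : ℂ) else 0) + (if K = 1 then -((s 0 : ℝ) : ℂ) else 0)‖ ^ 2 * f K = 0 := by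
    refine Finset.sum_eq_zero fun K hK => ?_
    have hK1 : K ≠ 1 := Finset.ne_of_mem_erase hK
    have hK2 : K ≠ -1 := Finset.ne_of_mem_erase (Finset.mem_of_mem_erase hK)
    simp [hK1, hK2]
  rw [hrest]
  norm_num [Complex.norm_real, Real.norm_eq_abs, sq_abs]
  ring

/-! ## §1 The invariant slow cone on an integer window -/

/-- **Invariant slow cone, integer-window form.** For a three-term ladder on a finite window `W ∋ 0, ±1` with real
links `s`, gap `d J ≥ d 0 + Δ` off `0`, coupling `|g| ≤ g_T` and `γ² = s 0² + s(−1)²`: if `0 < R`,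
`g_T γ (1 + R²) < Δ R` and `Σ_{J∈W∖0} ‖v_J(t₀)‖² < R² ‖v_0(t₀)‖²`, then `Σ_{J∈W∖0} ‖v_J(t)‖² ≤ R² ‖v_0(t)‖²` and
`v_0(t) ≠ 0` on `[t₀, t₁]`. [cite: KokotovicBensoussanBlankenship1987, Kokotović §2 eq. (2.29), Thm 2.3]
[cite: Chang1972] -/
theorem cone_intWindow (W : Finset ℤ) (h0 : (0 : ℤ) ∈ W) (h1 : (1 : ℤ) ∈ W) (hm1 : (-1 : ℤ) ∈ W)
    (d s : ℤ → ℝ) (Λ gT Δ γ R t₀ t₁ : ℝ) (g : ℝ → ℝ) (v : ℝ → ℤ → ℂ)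
    (hγ : γ ^ 2 = s 0 ^ 2 + s (-1) ^ 2) (hγ0 : 0 ≤ γ)
    (hΔ : ∀ J ∈ W, J ≠ 0 → d 0 + Δ ≤ d J) (hΛ : 0 < Λ)
    (hg : ∀ t ∈ Ioo t₀ t₁, |g t| ≤ gT) (hR : 0 < R) (htrap : gT * γ * (1 + R ^ 2) < Δ * R)
    (hsupp : ∀ t ∈ Icc t₀ t₁, ∀ J, J ∉ W → v t J = 0)
    (hderiv : ∀ t ∈ Icc t₀ t₁, ∀ J ∈ W, HasDerivWithinAt (fun τ => v τ J)
        (-(Λ : ℂ) * ((d J : ℂ) * v t J) - (g t : ℂ) * (Λ : ℂ) * ((s (J - 1) : ℂ) * v t (J - 1) - (s J : ℂ) * v t (J + 1)))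
        (Icc t₀ t₁) t)
    (hinit : ∑ J ∈ W.erase 0, ‖v t₀ J‖ ^ 2 < R ^ 2 * ‖v t₀ 0‖ ^ 2) :
    ∀ t ∈ Icc t₀ t₁, ∑ J ∈ W.erase 0, ‖v t J‖ ^ 2 ≤ R ^ 2 * ‖v t 0‖ ^ 2 ∧ 0 < ‖v t 0‖ := by
  classical
  -- packaging over `↥W`
  set o : ↥W := ⟨0, h0⟩ with ho
  set S : Matrix ↥W ↥W ℂ := fun J K => (if (K : ℤ) = (J : ℤ) - 1 then ((s ((J : ℤ) - 1) : ℝ) : ℂ) else 0) +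
    (if (K : ℤ) = (J : ℤ) + 1 then -((s (J : ℤ) : ℝ) : ℂ) else 0) with hSdef
  set V : ℝ → ↥W → ℂ := fun t J => v t J with hVdef
  set d' : ↥W → ℝ := fun J => d J with hd'
  have hS : ∀ J K, S K J = -conj (S J K) := fun J K => link_skew W s J K
  have hγ' : γ ^ 2 = ∑ K ∈ univ.erase o, ‖S o K‖ ^ 2 := by
    rw [hγ, ho]; exact (slowRow_norm_sq W h0 h1 hm1 s).symm
  have hΔ' : ∀ J : ↥W, J ≠ o → d' o + Δ ≤ d' J := fun J hJ =>
    hΔ J J.2 (fun h => hJ (Subtype.ext (by rw [ho]; exact h)))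
  have hcont : ContinuousOn V (Icc t₀ t₁) :=
    continuousOn_pi.2 fun J => fun t ht => (hderiv t ht J J.2).continuousWithinAt
  have hderiv' : ∀ t ∈ Ioo t₀ t₁, HasDerivAt V
      (fun J => -(Λ : ℂ) * ((d' J : ℂ) * V t J + (g t : ℂ) * ∑ K, S J K * V t K)) t := by
    intro t ht
    have htI : t ∈ Icc t₀ t₁ := Ioo_subset_Icc_self ht
    rw [hasDerivAt_pi]
    intro J
    have h := (hderiv t htI J J.2).hasDerivAt (Icc_mem_nhds ht.1 ht.2)
    refine h.congr_deriv ?_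
    simp only [hVdef, hSdef, hd']
    rw [sum_link_apply W s (hsupp t htI) (J : ℤ)]
    ring
  have hinit' : ∑ J ∈ univ.erase o, ‖V t₀ J‖ ^ 2 < R ^ 2 * ‖V t₀ o‖ ^ 2 := by
    simp only [hVdef, ho]
    rw [sum_univ_erase_eq W h0 (fun J => ‖v t₀ J‖ ^ 2)]; exact hinit
  intro t ht
  have key := slowCone_invariant S d' o Λ gT Δ γ R t₀ t₁ g V hS hγ' hγ0 hΔ' hΛ hg hR htrap hcont hderiv'
    hinit' t ht
  simp only [hVdef, ho] at key
  rw [sum_univ_erase_eq W h0 (fun J => ‖v t J‖ ^ 2)] at key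
  exact key

/-- **Crude two-sided slow law, integer-window form**: inside the cone of `cone_intWindow` (taken as hypothesis),
`|log ‖v_0(t)‖² − log ‖v_0(t₀)‖² + 2Λ d_0 (t − t₀)| ≤ 2Λ g_T γ R (t − t₀)` on `[t₀, t₁]`.
[cite: Eastham1989, §1.5 Thm 1.5.1] -/
theorem abs_log_sub_le_intWindow (W : Finset ℤ) (h0 : (0 : ℤ) ∈ W) (h1 : (1 : ℤ) ∈ W) (hm1 : (-1 : ℤ) ∈ W)
    (d s : ℤ → ℝ) (Λ gT γ R t₀ t₁ : ℝ) (g : ℝ → ℝ) (v : ℝ → ℤ → ℂ)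
    (hγ : γ ^ 2 = s 0 ^ 2 + s (-1) ^ 2) (hγ0 : 0 ≤ γ) (hΛ : 0 < Λ)
    (hg : ∀ t ∈ Ioo t₀ t₁, |g t| ≤ gT) (hR : 0 ≤ R)
    (hsupp : ∀ t ∈ Icc t₀ t₁, ∀ J, J ∉ W → v t J = 0)
    (hderiv : ∀ t ∈ Icc t₀ t₁, ∀ J ∈ W, HasDerivWithinAt (fun τ => v τ J)
        (-(Λ : ℂ) * ((d J : ℂ) * v t J) - (g t : ℂ) * (Λ : ℂ) * ((s (J - 1) : ℂ) * v t (J - 1) - (s J : ℂ) * v t (J + 1)))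
        (Icc t₀ t₁) t)
    (hcone : ∀ t ∈ Icc t₀ t₁, ∑ J ∈ W.erase 0, ‖v t J‖ ^ 2 ≤ R ^ 2 * ‖v t 0‖ ^ 2 ∧ 0 < ‖v t 0‖) :
    ∀ t ∈ Icc t₀ t₁, |Real.log (‖v t 0‖ ^ 2) - Real.log (‖v t₀ 0‖ ^ 2) + 2 * Λ * d 0 * (t - t₀)| ≤
      2 * Λ * gT * γ * R * (t - t₀) := by
  classical
  set o : ↥W := ⟨0, h0⟩ with ho
  set S : Matrix ↥W ↥W ℂ := fun J K => (if (K : ℤ) = (J : ℤ) - 1 then ((s ((J : ℤ) - 1) : ℝ) : ℂ) else 0) +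
    (if (K : ℤ) = (J : ℤ) + 1 then -((s (J : ℤ) : ℝ) : ℂ) else 0) with hSdef
  set V : ℝ → ↥W → ℂ := fun t J => v t J with hVdef
  set d' : ↥W → ℝ := fun J => d J with hd'
  have hS : ∀ J K, S K J = -conj (S J K) := fun J K => link_skew W s J K
  have hγ' : γ ^ 2 = ∑ K ∈ univ.erase o, ‖S o K‖ ^ 2 := by
    rw [hγ, ho]; exact (slowRow_norm_sq W h0 h1 hm1 s).symm
  have hcont : ContinuousOn V (Icc t₀ t₁) :=
    continuousOn_pi.2 fun J => fun t ht => (hderiv t ht J J.2).continuousWithinAt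
  have hderiv' : ∀ t ∈ Ioo t₀ t₁, HasDerivAt V
      (fun J => -(Λ : ℂ) * ((d' J : ℂ) * V t J + (g t : ℂ) * ∑ K, S J K * V t K)) t := by
    intro t ht
    have htI : t ∈ Icc t₀ t₁ := Ioo_subset_Icc_self ht
    rw [hasDerivAt_pi]
    intro J
    have h := (hderiv t htI J J.2).hasDerivAt (Icc_mem_nhds ht.1 ht.2)
    refine h.congr_deriv ?_
    simp only [hVdef, hSdef, hd']
    rw [sum_link_apply W s (hsupp t htI) (J : ℤ)]
    ring
  have hcone' : ∀ t ∈ Icc t₀ t₁, ∑ J ∈ univ.erase o, ‖V t J‖ ^ 2 ≤ R ^ 2 * ‖V t o‖ ^ 2 ∧ 0 < ‖V t o‖ := by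
    intro t ht
    simp only [hVdef, ho]
    rw [sum_univ_erase_eq W h0 (fun J => ‖v t J‖ ^ 2)]; exact hcone t ht
  intro t ht
  have key := abs_log_slowEnergy_sub_le S d' o Λ gT γ R t₀ t₁ g V hS hγ' hγ0 hΛ hg hR hcont hderiv' hcone' t ht
  simpa [hVdef, ho, hd'] using key

/-! ## §2 The slot-column law to second order -/

/-- **The slot-column law, integer-window form (uniform in the window).** Three-term ladder on `W ∋ 0, ±1` with real
links `|s| ≤ 1`, gap `d J ≥ d 0 + Δ` off `0` (`Δ > 0`), coupling `|g| ≤ g_T`, `γ² = s 0² + s(−1)²`, cone radius `R`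
with `g_T γ (1 + R²) < Δ R`. Start from the COLUMN datum `v_J(t₀) = 0` (`J ≠ 0`), `v_0(t₀) ≠ 0`. Let `j₁, j₋₁` be
the real Duhamel responses of `g` at the rates `Λ(d_{±1} − d_0)`, i.e. `j' = g − Λ(d_{±1} − d_0) j`, `j(t₀) = 0`
(`LatticeShear.hasDerivAt_duhamel` after the time change), and `Φ` any primitive of `Λ g (s 0² j₁ + s(−1)² j₋₁)`.
Then on `[t₀, t₁]` the slow mode obeys the TWO-SIDED law
`|log ‖v_0(t)‖² − log ‖v_0(t₀)‖² + 2Λ d_0 (t − t₀) + 2Λ (Φ t − Φ t₀)| ≤ 2Λ g_T γ Q (t − t₀)`, `Q = g_T R (2 + γR)/Δ`,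
and stays in the cone (`cone_intWindow`). This is Hartman–Wintner's exponent `λ_k + r_kk` plus the second-order
(Taylor) correction of the Riccati decoupling, with an explicit remainder, for one column of the slot propagator.
[cite: Eastham1989, §1.5 Thm 1.5.1 (1.5.5), §1.6 Thm 1.6.1] [cite: KokotovicBensoussanBlankenship1987, Kokotović §2 Thm 2.3 (2.40)] -/
theorem column_law_intWindow (W : Finset ℤ) (h0 : (0 : ℤ) ∈ W) (h1 : (1 : ℤ) ∈ W) (hm1 : (-1 : ℤ) ∈ W)
    (d s : ℤ → ℝ) (Λ gT Δ γ R t₀ t₁ : ℝ) (g Φ j₁ jm : ℝ → ℝ) (v : ℝ → ℤ → ℂ)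
    (hs : ∀ J ∈ W, |s J| ≤ 1) (hγ : γ ^ 2 = s 0 ^ 2 + s (-1) ^ 2) (hγ0 : 0 ≤ γ)
    (hΔ : ∀ J ∈ W, J ≠ 0 → d 0 + Δ ≤ d J) (hΔ0 : 0 < Δ) (hΛ : 0 < Λ)
    (hg : ∀ t ∈ Ioo t₀ t₁, |g t| ≤ gT) (hgT : 0 ≤ gT) (hR : 0 < R) (htrap : gT * γ * (1 + R ^ 2) < Δ * R)
    (hsupp : ∀ t ∈ Icc t₀ t₁, ∀ J, J ∉ W → v t J = 0)
    (hderiv : ∀ t ∈ Icc t₀ t₁, ∀ J ∈ W, HasDerivWithinAt (fun τ => v τ J)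
        (-(Λ : ℂ) * ((d J : ℂ) * v t J) - (g t : ℂ) * (Λ : ℂ) * ((s (J - 1) : ℂ) * v t (J - 1) - (s J : ℂ) * v t (J + 1)))
        (Icc t₀ t₁) t)
    (hcol : ∀ J, J ≠ 0 → v t₀ J = 0) (hv0 : v t₀ 0 ≠ 0)
    (hj₁ : ∀ t ∈ Icc t₀ t₁, HasDerivWithinAt j₁ (g t - Λ * (d 1 - d 0) * j₁ t) (Icc t₀ t₁) t) (hj₁0 : j₁ t₀ = 0)
    (hjm : ∀ t ∈ Icc t₀ t₁, HasDerivWithinAt jm (g t - Λ * (d (-1) - d 0) * jm t) (Icc t₀ t₁) t)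
    (hjm0 : jm t₀ = 0)
    (hΦ : ∀ t ∈ Icc t₀ t₁, HasDerivWithinAt Φ (Λ * g t * (s 0 ^ 2 * j₁ t + s (-1) ^ 2 * jm t)) (Icc t₀ t₁) t) :
    ∀ t ∈ Icc t₀ t₁, |Real.log (‖v t 0‖ ^ 2) - Real.log (‖v t₀ 0‖ ^ 2) + 2 * Λ * d 0 * (t - t₀) +
        2 * Λ * (Φ t - Φ t₀)| ≤ 2 * Λ * gT * γ * (gT * R * (2 + γ * R) / Δ) * (t - t₀) := by
  classical
  -- packaging over `↥W`
  set o : ↥W := ⟨0, h0⟩ with ho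
  set S : Matrix ↥W ↥W ℂ := fun J K => (if (K : ℤ) = (J : ℤ) - 1 then ((s ((J : ℤ) - 1) : ℝ) : ℂ) else 0) +
    (if (K : ℤ) = (J : ℤ) + 1 then -((s (J : ℤ) : ℝ) : ℂ) else 0) with hSdef
  set V : ℝ → ↥W → ℂ := fun t J => v t J with hVdef
  set d' : ↥W → ℝ := fun J => d J with hd'
  have hS : ∀ J K, S K J = -conj (S J K) := fun J K => link_skew W s J K
  have hγ' : γ ^ 2 = ∑ K ∈ univ.erase o, ‖S o K‖ ^ 2 := by
    rw [hγ, ho]; exact (slowRow_norm_sq W h0 h1 hm1 s).symm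
  have hΔ' : ∀ J : ↥W, J ≠ o → d' o + Δ ≤ d' J := fun J hJ =>
    hΔ J J.2 (fun h => hJ (Subtype.ext (by rw [ho]; exact h)))
  have hcont : ContinuousOn V (Icc t₀ t₁) :=
    continuousOn_pi.2 fun J => fun t ht => (hderiv t ht J J.2).continuousWithinAt
  have hderiv' : ∀ t ∈ Ioo t₀ t₁, HasDerivAt V
      (fun J => -(Λ : ℂ) * ((d' J : ℂ) * V t J + (g t : ℂ) * ∑ K, S J K * V t K)) t := by
    intro t ht
    have htI : t ∈ Icc t₀ t₁ := Ioo_subset_Icc_self ht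
    rw [hasDerivAt_pi]
    intro J
    have h := (hderiv t htI J J.2).hasDerivAt (Icc_mem_nhds ht.1 ht.2)
    refine h.congr_deriv ?_
    simp only [hVdef, hSdef, hd']
    rw [sum_link_apply W s (hsupp t htI) (J : ℤ)]
    ring
  -- the cone, from the column datum
  have hcone := cone_intWindow W h0 h1 hm1 d s Λ gT Δ γ R t₀ t₁ g v hγ hγ0 hΔ hΛ hg hR htrap hsupp hderiv (by
    rw [Finset.sum_eq_zero fun J hJ => by rw [hcol J (Finset.ne_of_mem_erase hJ), norm_zero]; ring]
    positivity)
  have hcone' : ∀ t ∈ Icc t₀ t₁, ∑ J ∈ univ.erase o, ‖V t J‖ ^ 2 ≤ R ^ 2 * ‖V t o‖ ^ 2 ∧ 0 < ‖V t o‖ := by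
    intro t ht
    simp only [hVdef, ho]
    rw [sum_univ_erase_eq W h0 (fun J => ‖v t J‖ ^ 2)]; exact hcone t ht
  -- the first-order family `ρ_K = −Λ S_{K0} j_K`, `j_K ∈ {j₁, j₋₁, 0}`
  set jj : ℝ → ↥W → ℝ := fun t K => if (K : ℤ) = 1 then j₁ t else if (K : ℤ) = -1 then jm t else 0 with hjj
  set ρ : ℝ → ↥W → ℂ := fun t K => -(Λ : ℂ) * S K o * (jj t K : ℂ) with hρdef
  have hSKo : ∀ K : ↥W, (K : ℤ) ≠ 1 → (K : ℤ) ≠ -1 → S K o = 0 := by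
    intro K hK1 hK2
    simp only [hSdef, ho]
    have e1 : ¬ ((0 : ℤ) = (K : ℤ) - 1) := by omega
    have e2 : ¬ ((0 : ℤ) = (K : ℤ) + 1) := by omega
    rw [if_neg e1, if_neg e2, add_zero]
  have hρc : ∀ K, K ≠ o → ContinuousOn (fun t => ρ t K) (Icc t₀ t₁) := by
    intro K _
    simp only [hρdef]
    refine ContinuousOn.mul continuousOn_const (Complex.continuous_ofReal.comp_continuousOn ?_)
    simp only [hjj]
    split_ifs
    · exact fun t ht => (hj₁ t ht).continuousWithinAt
    · exact fun t ht => (hjm t ht).continuousWithinAt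
    · exact continuousOn_const
  have hρd : ∀ t ∈ Ioo t₀ t₁, ∀ K, K ≠ o → HasDerivAt (fun τ => ρ τ K)
      (-(Λ : ℂ) * (((d' K - d' o : ℝ) : ℂ) * ρ t K + (g t : ℂ) * S K o)) t := by
    intro t ht K _
    have htI : t ∈ Icc t₀ t₁ := Ioo_subset_Icc_self ht
    simp only [hρdef, hjj, hd', ho]
    by_cases hK1 : (K : ℤ) = 1
    · simp only [hK1, if_true]
      have hj := (hj₁ t htI).hasDerivAt (Icc_mem_nhds ht.1 ht.2)
      have := hasDerivAt_duhamelMode S d' o K Λ (g t) j₁ _ t hj (by simp only [hd', ho, hK1])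
      simp only [hd', ho, hK1] at this
      exact this
    · by_cases hK2 : (K : ℤ) = -1
      · have hK1' : ¬ ((-1 : ℤ) = 1) := by norm_num
        simp only [hK2, hK1', if_false, if_true]
        have hj := (hjm t htI).hasDerivAt (Icc_mem_nhds ht.1 ht.2)
        have := hasDerivAt_duhamelMode S d' o K Λ (g t) jm _ t hj (by simp only [hd', ho, hK2])
        simp only [hd', ho, hK2] at this
        exact this
      · simp only [hK1, hK2, if_false]
        have h0' : S K o = 0 := hSKo K hK1 hK2
        rw [ho] at h0'
        rw [h0']
        simpa using hasDerivAt_const t (0 : ℂ)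
  have hρa : ∀ K, K ≠ o → ρ t₀ K = V t₀ K / V t₀ o := by
    intro K hK
    have hK0 : (K : ℤ) ≠ 0 := fun h => hK (Subtype.ext (by rw [ho]; exact h))
    simp only [hρdef, hVdef, hjj, hj₁0, hjm0, ho]
    rw [hcol _ hK0, zero_div]
    split_ifs <;> simp
  -- remainder bound with the Schur constant `σ = 2` and `S o o = 0`
  have hrow : ∀ J : ↥W, J ≠ o → ∑ K ∈ univ.erase o, ‖S J K‖ ≤ 2 := fun J _ => by
    simp only [hSdef, ho]; exact link_rowSum_le_two W h0 s hs J
  have hrem := ratio_remainder_le_of_rowSum S d' o Λ gT Δ γ R 2 t₀ t₁ g V ρ hS hγ' hγ0 hΔ' hΔ0 hΛ hg hgT hR.le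
    (by norm_num) hrow hcont hderiv' hcone' hρc hρd hρa
  have hSoo : ‖S o o‖ = 0 := by
    simp only [hSdef, ho]
    norm_num
  rw [hSoo, add_zero] at hrem
  -- the exponent
  have hQ0 : 0 ≤ gT * R * (2 + γ * R) / Δ := by positivity
  have hpos : ∀ t ∈ Icc t₀ t₁, 0 < ‖V t o‖ := fun t ht => (hcone' t ht).2
  have hΦc : ContinuousOn Φ (Icc t₀ t₁) := fun t ht => (hΦ t ht).continuousWithinAt
  have hΦd : ∀ t ∈ Ioo t₀ t₁, HasDerivAt Φ (g t * (∑ K ∈ univ.erase o, S o K * ρ t K).re) t := by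
    intro t ht
    have htI : t ∈ Icc t₀ t₁ := Ioo_subset_Icc_self ht
    have h := (hΦ t htI).hasDerivAt (Icc_mem_nhds ht.1 ht.2)
    refine h.congr_deriv ?_
    rw [re_sum_mul_duhamelMode S o Λ (ρ t) (jj t) hS (fun K _ => rfl)]
    have hw := slowRow_norm_sq_mul W h0 h1 hm1 s (fun K => if K = 1 then j₁ t else if K = -1 then jm t else 0)
    simp only [hjj, ho] at hw ⊢
    rw [hw]
    norm_num
    ring
  intro t ht
  have key := abs_log_slowEnergy_expansion_le S d' o Λ gT γ (gT * R * (2 + γ * R) / Δ) t₀ t₁ g Φ V ρ hS hγ' hγ0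
    hΛ hg hQ0 hcont hderiv' hpos hrem hΦc hΦd t ht
  simpa [hVdef, ho, hd'] using key

/-! ## §3 The other columns: data off the cone -/

/-- **Fast-to-slow feed and fast decay, integer-window form.** Three-term ladder on `W ∋ 0, ±1` with real links,
gap `d J ≥ d 0 + Δ` off `0` (`Δ > 0`), `d 0 ≥ 0`, coupling `|g| ≤ g_T`, `γ² = s 0² + s(−1)²`. For ANY datum
(no cone condition), with `Z(t) = Σ_{J∈W∖0} ‖v_J(t)‖²`, on `[t₀, t₁]`:
`‖v_0(t)‖ ≤ e^{Λ(g_Tγ)²(t−t₀)/Δ}(‖v_0(t₀)‖ + (g_Tγ/Δ)√Z(t₀))` and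
`√Z(t) ≤ e^{−ΛΔ(t−t₀)}√Z(t₀) + (g_Tγ/Δ)·e^{Λ(g_Tγ)²(t−t₀)/Δ}(‖v_0(t₀)‖ + (g_Tγ/Δ)√Z(t₀))` — the columns `e_J`,
`J ≠ 0`, of the slot propagator feed the slow mode by at most `g_Tγ/Δ` and relax at the gap rate.
[cite: KokotovicBensoussanBlankenship1987, Kokotović §2 (2.16)–(2.20), Thm 2.3] -/
theorem offCone_intWindow (W : Finset ℤ) (h0 : (0 : ℤ) ∈ W) (h1 : (1 : ℤ) ∈ W) (hm1 : (-1 : ℤ) ∈ W)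
    (d s : ℤ → ℝ) (Λ gT Δ γ t₀ t₁ : ℝ) (g : ℝ → ℝ) (v : ℝ → ℤ → ℂ)
    (hγ : γ ^ 2 = s 0 ^ 2 + s (-1) ^ 2) (hγ0 : 0 ≤ γ)
    (hΔ : ∀ J ∈ W, J ≠ 0 → d 0 + Δ ≤ d J) (hΔ0 : 0 < Δ) (hd0 : 0 ≤ d 0) (hΛ : 0 < Λ)
    (hg : ∀ t ∈ Ioo t₀ t₁, |g t| ≤ gT) (hgT : 0 ≤ gT)
    (hsupp : ∀ t ∈ Icc t₀ t₁, ∀ J, J ∉ W → v t J = 0)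
    (hderiv : ∀ t ∈ Icc t₀ t₁, ∀ J ∈ W, HasDerivWithinAt (fun τ => v τ J)
        (-(Λ : ℂ) * ((d J : ℂ) * v t J) - (g t : ℂ) * (Λ : ℂ) * ((s (J - 1) : ℂ) * v t (J - 1) - (s J : ℂ) * v t (J + 1)))
        (Icc t₀ t₁) t) :
    ∀ t ∈ Icc t₀ t₁,
      ‖v t 0‖ ≤ Real.exp (Λ * (gT * γ) ^ 2 / Δ * (t - t₀)) *
          (‖v t₀ 0‖ + gT * γ / Δ * Real.sqrt (∑ J ∈ W.erase 0, ‖v t₀ J‖ ^ 2)) ∧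
      Real.sqrt (∑ J ∈ W.erase 0, ‖v t J‖ ^ 2) ≤
        Real.exp (-(Λ * Δ) * (t - t₀)) * Real.sqrt (∑ J ∈ W.erase 0, ‖v t₀ J‖ ^ 2) +
          gT * γ / Δ * (Real.exp (Λ * (gT * γ) ^ 2 / Δ * (t - t₀)) *
            (‖v t₀ 0‖ + gT * γ / Δ * Real.sqrt (∑ J ∈ W.erase 0, ‖v t₀ J‖ ^ 2))) := by
  classical
  set o : ↥W := ⟨0, h0⟩ with ho
  set S : Matrix ↥W ↥W ℂ := fun J K => (if (K : ℤ) = (J : ℤ) - 1 then ((s ((J : ℤ) - 1) : ℝ) : ℂ) else 0) +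
    (if (K : ℤ) = (J : ℤ) + 1 then -((s (J : ℤ) : ℝ) : ℂ) else 0) with hSdef
  set V : ℝ → ↥W → ℂ := fun t J => v t J with hVdef
  set d' : ↥W → ℝ := fun J => d J with hd'
  have hS : ∀ J K, S K J = -conj (S J K) := fun J K => link_skew W s J K
  have hγ' : γ ^ 2 = ∑ K ∈ univ.erase o, ‖S o K‖ ^ 2 := by
    rw [hγ, ho]; exact (slowRow_norm_sq W h0 h1 hm1 s).symm
  have hΔ' : ∀ J : ↥W, J ≠ o → d' o + Δ ≤ d' J := fun J hJ =>
    hΔ J J.2 (fun h => hJ (Subtype.ext (by rw [ho]; exact h)))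
  have hd0' : 0 ≤ d' o := by simp only [hd', ho]; exact hd0
  have hcont : ContinuousOn V (Icc t₀ t₁) :=
    continuousOn_pi.2 fun J => fun t ht => (hderiv t ht J J.2).continuousWithinAt
  have hderiv' : ∀ t ∈ Ioo t₀ t₁, HasDerivAt V
      (fun J => -(Λ : ℂ) * ((d' J : ℂ) * V t J + (g t : ℂ) * ∑ K, S J K * V t K)) t := by
    intro t ht
    have htI : t ∈ Icc t₀ t₁ := Ioo_subset_Icc_self ht
    rw [hasDerivAt_pi]
    intro J
    have h := (hderiv t htI J J.2).hasDerivAt (Icc_mem_nhds ht.1 ht.2)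
    refine h.congr_deriv ?_
    simp only [hVdef, hSdef, hd']
    rw [sum_link_apply W s (hsupp t htI) (J : ℤ)]
    ring
  intro t ht
  have k1 := norm_slow_le_of_gap S d' o Λ gT Δ γ t₀ t₁ g V hS hγ' hγ0 hΔ' hΔ0 hd0' hΛ hg hgT hcont hderiv' t ht
  have k2 := sqrt_fast_le_of_gap S d' o Λ gT Δ γ t₀ t₁ g V hS hγ' hγ0 hΔ' hΔ0 hd0' hΛ hg hgT hcont hderiv' t ht
  simp only [hVdef, ho] at k1 k2
  rw [sum_univ_erase_eq W h0 (fun J => ‖v t₀ J‖ ^ 2)] at k1 k2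
  rw [sum_univ_erase_eq W h0 (fun J => ‖v t J‖ ^ 2)] at k2
  exact ⟨k1, k2⟩

/-- **The slaved fast profile of the slot column, integer-window form.** Under the hypotheses of
`column_law_intWindow` (without `Φ`): along the column (`v_J(t₀) = 0` for `J ≠ 0`), the ratios `v_J/v_0` stay within
`Q = g_T R (2 + γR)/Δ` (in `ℓ²(W∖0)`) of the explicit first-order profile `ρ_{1} = −Λ s 0·j₁`, `ρ_{−1} = +Λ s(−1)·j₋₁`,
`ρ_J = 0` otherwise — in particular at the END of a slot, where the ramps have relaxed `j_{±1}`, the fast residual of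
the column is `≤ (‖ρ(t₁)‖ + Q)·‖v_0(t₁)‖`. [cite: Eastham1989, §1.5 Thm 1.5.1, (1.5.8)–(1.5.10)] -/
theorem column_remainder_intWindow (W : Finset ℤ) (h0 : (0 : ℤ) ∈ W) (h1 : (1 : ℤ) ∈ W) (hm1 : (-1 : ℤ) ∈ W)
    (d s : ℤ → ℝ) (Λ gT Δ γ R t₀ t₁ : ℝ) (g j₁ jm : ℝ → ℝ) (v : ℝ → ℤ → ℂ)
    (hs : ∀ J ∈ W, |s J| ≤ 1) (hγ : γ ^ 2 = s 0 ^ 2 + s (-1) ^ 2) (hγ0 : 0 ≤ γ)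
    (hΔ : ∀ J ∈ W, J ≠ 0 → d 0 + Δ ≤ d J) (hΔ0 : 0 < Δ) (hΛ : 0 < Λ)
    (hg : ∀ t ∈ Ioo t₀ t₁, |g t| ≤ gT) (hgT : 0 ≤ gT) (hR : 0 < R) (htrap : gT * γ * (1 + R ^ 2) < Δ * R)
    (hsupp : ∀ t ∈ Icc t₀ t₁, ∀ J, J ∉ W → v t J = 0)
    (hderiv : ∀ t ∈ Icc t₀ t₁, ∀ J ∈ W, HasDerivWithinAt (fun τ => v τ J)
        (-(Λ : ℂ) * ((d J : ℂ) * v t J) - (g t : ℂ) * (Λ : ℂ) * ((s (J - 1) : ℂ) * v t (J - 1) - (s J : ℂ) * v t (J + 1)))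
        (Icc t₀ t₁) t)
    (hcol : ∀ J, J ≠ 0 → v t₀ J = 0) (hv0 : v t₀ 0 ≠ 0)
    (hj₁ : ∀ t ∈ Icc t₀ t₁, HasDerivWithinAt j₁ (g t - Λ * (d 1 - d 0) * j₁ t) (Icc t₀ t₁) t) (hj₁0 : j₁ t₀ = 0)
    (hjm : ∀ t ∈ Icc t₀ t₁, HasDerivWithinAt jm (g t - Λ * (d (-1) - d 0) * jm t) (Icc t₀ t₁) t)
    (hjm0 : jm t₀ = 0) :
    ∀ t ∈ Icc t₀ t₁, ∑ J ∈ W.erase 0, ‖v t J / v t 0 -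
        (if J = 1 then -(Λ : ℂ) * (s 0 : ℂ) * (j₁ t : ℂ) else if J = -1 then (Λ : ℂ) * (s (-1) : ℂ) * (jm t : ℂ) else 0)‖ ^ 2
      ≤ (gT * R * (2 + γ * R) / Δ) ^ 2 := by
  classical
  -- packaging over `↥W`
  set o : ↥W := ⟨0, h0⟩ with ho
  set S : Matrix ↥W ↥W ℂ := fun J K => (if (K : ℤ) = (J : ℤ) - 1 then ((s ((J : ℤ) - 1) : ℝ) : ℂ) else 0) +
    (if (K : ℤ) = (J : ℤ) + 1 then -((s (J : ℤ) : ℝ) : ℂ) else 0) with hSdef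
  set V : ℝ → ↥W → ℂ := fun t J => v t J with hVdef
  set d' : ↥W → ℝ := fun J => d J with hd'
  have hS : ∀ J K, S K J = -conj (S J K) := fun J K => link_skew W s J K
  have hγ' : γ ^ 2 = ∑ K ∈ univ.erase o, ‖S o K‖ ^ 2 := by
    rw [hγ, ho]; exact (slowRow_norm_sq W h0 h1 hm1 s).symm
  have hΔ' : ∀ J : ↥W, J ≠ o → d' o + Δ ≤ d' J := fun J hJ =>
    hΔ J J.2 (fun h => hJ (Subtype.ext (by rw [ho]; exact h)))
  have hcont : ContinuousOn V (Icc t₀ t₁) :=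
    continuousOn_pi.2 fun J => fun t ht => (hderiv t ht J J.2).continuousWithinAt
  have hderiv' : ∀ t ∈ Ioo t₀ t₁, HasDerivAt V
      (fun J => -(Λ : ℂ) * ((d' J : ℂ) * V t J + (g t : ℂ) * ∑ K, S J K * V t K)) t := by
    intro t ht
    have htI : t ∈ Icc t₀ t₁ := Ioo_subset_Icc_self ht
    rw [hasDerivAt_pi]
    intro J
    have h := (hderiv t htI J J.2).hasDerivAt (Icc_mem_nhds ht.1 ht.2)
    refine h.congr_deriv ?_
    simp only [hVdef, hSdef, hd']
    rw [sum_link_apply W s (hsupp t htI) (J : ℤ)]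
    ring
  -- the cone, from the column datum
  have hcone := cone_intWindow W h0 h1 hm1 d s Λ gT Δ γ R t₀ t₁ g v hγ hγ0 hΔ hΛ hg hR htrap hsupp hderiv (by
    rw [Finset.sum_eq_zero fun J hJ => by rw [hcol J (Finset.ne_of_mem_erase hJ), norm_zero]; ring]
    positivity)
  have hcone' : ∀ t ∈ Icc t₀ t₁, ∑ J ∈ univ.erase o, ‖V t J‖ ^ 2 ≤ R ^ 2 * ‖V t o‖ ^ 2 ∧ 0 < ‖V t o‖ := by
    intro t ht
    simp only [hVdef, ho]
    rw [sum_univ_erase_eq W h0 (fun J => ‖v t J‖ ^ 2)]; exact hcone t ht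
  -- the first-order family `ρ_K = −Λ S_{K0} j_K`, `j_K ∈ {j₁, j₋₁, 0}`
  set jj : ℝ → ↥W → ℝ := fun t K => if (K : ℤ) = 1 then j₁ t else if (K : ℤ) = -1 then jm t else 0 with hjj
  set ρ : ℝ → ↥W → ℂ := fun t K => -(Λ : ℂ) * S K o * (jj t K : ℂ) with hρdef
  have hSKo : ∀ K : ↥W, (K : ℤ) ≠ 1 → (K : ℤ) ≠ -1 → S K o = 0 := by
    intro K hK1 hK2
    simp only [hSdef, ho]
    have e1 : ¬ ((0 : ℤ) = (K : ℤ) - 1) := by omega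
    have e2 : ¬ ((0 : ℤ) = (K : ℤ) + 1) := by omega
    rw [if_neg e1, if_neg e2, add_zero]
  have hρc : ∀ K, K ≠ o → ContinuousOn (fun t => ρ t K) (Icc t₀ t₁) := by
    intro K _
    simp only [hρdef]
    refine ContinuousOn.mul continuousOn_const (Complex.continuous_ofReal.comp_continuousOn ?_)
    simp only [hjj]
    split_ifs
    · exact fun t ht => (hj₁ t ht).continuousWithinAt
    · exact fun t ht => (hjm t ht).continuousWithinAt
    · exact continuousOn_const
  have hρd : ∀ t ∈ Ioo t₀ t₁, ∀ K, K ≠ o → HasDerivAt (fun τ => ρ τ K)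
      (-(Λ : ℂ) * (((d' K - d' o : ℝ) : ℂ) * ρ t K + (g t : ℂ) * S K o)) t := by
    intro t ht K _
    have htI : t ∈ Icc t₀ t₁ := Ioo_subset_Icc_self ht
    simp only [hρdef, hjj, hd', ho]
    by_cases hK1 : (K : ℤ) = 1
    · simp only [hK1, if_true]
      have hj := (hj₁ t htI).hasDerivAt (Icc_mem_nhds ht.1 ht.2)
      have := hasDerivAt_duhamelMode S d' o K Λ (g t) j₁ _ t hj (by simp only [hd', ho, hK1])
      simp only [hd', ho, hK1] at this
      exact this
    · by_cases hK2 : (K : ℤ) = -1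
      · have hK1' : ¬ ((-1 : ℤ) = 1) := by norm_num
        simp only [hK2, hK1', if_false, if_true]
        have hj := (hjm t htI).hasDerivAt (Icc_mem_nhds ht.1 ht.2)
        have := hasDerivAt_duhamelMode S d' o K Λ (g t) jm _ t hj (by simp only [hd', ho, hK2])
        simp only [hd', ho, hK2] at this
        exact this
      · simp only [hK1, hK2, if_false]
        have h0' : S K o = 0 := hSKo K hK1 hK2
        rw [ho] at h0'
        rw [h0']
        simpa using hasDerivAt_const t (0 : ℂ)
  have hρa : ∀ K, K ≠ o → ρ t₀ K = V t₀ K / V t₀ o := by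
    intro K hK
    have hK0 : (K : ℤ) ≠ 0 := fun h => hK (Subtype.ext (by rw [ho]; exact h))
    simp only [hρdef, hVdef, hjj, hj₁0, hjm0, ho]
    rw [hcol _ hK0, zero_div]
    split_ifs <;> simp
  -- remainder bound with the Schur constant `σ = 2` and `S o o = 0`
  have hrow : ∀ J : ↥W, J ≠ o → ∑ K ∈ univ.erase o, ‖S J K‖ ≤ 2 := fun J _ => by
    simp only [hSdef, ho]; exact link_rowSum_le_two W h0 s hs J
  have hrem := ratio_remainder_le_of_rowSum S d' o Λ gT Δ γ R 2 t₀ t₁ g V ρ hS hγ' hγ0 hΔ' hΔ0 hΛ hg hgT hR.le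
    (by norm_num) hrow hcont hderiv' hcone' hρc hρd hρa
  have hSoo : ‖S o o‖ = 0 := by
    simp only [hSdef, ho]
    norm_num
  rw [hSoo, add_zero] at hrem
  intro t ht
  have key := hrem t ht
  -- identify the internal profile `ρ t K = −Λ S K o · jj t K` with the explicit one
  have hρ_explicit : ∀ K : ↥W, ρ t K =
      (if (K : ℤ) = 1 then -(Λ : ℂ) * (s 0 : ℂ) * (j₁ t : ℂ) else
        if (K : ℤ) = -1 then (Λ : ℂ) * (s (-1) : ℂ) * (jm t : ℂ) else 0) := by
    intro K
    simp only [hρdef, hjj, hSdef, ho]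
    by_cases hK1 : (K : ℤ) = 1
    · have e1 : ((0 : ℤ) = (K : ℤ) - 1) := by omega
      have e2 : ¬ ((0 : ℤ) = (K : ℤ) + 1) := by omega
      rw [if_pos e1, if_neg e2, if_pos hK1, if_pos hK1, hK1]
      push_cast
      ring
    · by_cases hK2 : (K : ℤ) = -1
      · have e1 : ¬ ((0 : ℤ) = (K : ℤ) - 1) := by omega
        have e2 : ((0 : ℤ) = (K : ℤ) + 1) := by omega
        rw [if_neg e1, if_pos e2, if_neg hK1, if_pos hK2, if_neg hK1, if_pos hK2, hK2]
        ring
      · have e1 : ¬ ((0 : ℤ) = (K : ℤ) - 1) := by omega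
        have e2 : ¬ ((0 : ℤ) = (K : ℤ) + 1) := by omega
        rw [if_neg e1, if_neg e2, if_neg hK1, if_neg hK2, if_neg hK1, if_neg hK2]
        simp
  have key' : ∑ J ∈ univ.erase o, ‖V t J / V t o -
      (if ((J : ↥W) : ℤ) = 1 then -(Λ : ℂ) * (s 0 : ℂ) * (j₁ t : ℂ) else
        if ((J : ↥W) : ℤ) = -1 then (Λ : ℂ) * (s (-1) : ℂ) * (jm t : ℂ) else 0)‖ ^ 2 ≤
      (gT * R * (2 + γ * R) / Δ) ^ 2 := by
    refine le_trans (le_of_eq (Finset.sum_congr rfl fun J _ => by rw [← hρ_explicit J])) key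
  simp only [hVdef, ho] at key'
  rw [sum_univ_erase_eq W h0 (fun J => ‖v t J / v t 0 -
      (if J = 1 then -(Λ : ℂ) * (s 0 : ℂ) * (j₁ t : ℂ) else if J = -1 then (Λ : ℂ) * (s (-1) : ℂ) * (jm t : ℂ) else 0)‖ ^ 2)]
    at key'
  exact key'

/-! ## §4 Reality: real data stay real; the slot multiplier of the column carries no phase -/

/-- The link matrix with real links has real entries. [folklore] -/
private theorem link_real (W : Finset ℤ) (s : ℤ → ℝ) (J K : ↥W) :
    conj ((if (K : ℤ) = (J : ℤ) - 1 then ((s ((J : ℤ) - 1) : ℝ) : ℂ) else 0) +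
        (if (K : ℤ) = (J : ℤ) + 1 then -((s (J : ℤ) : ℝ) : ℂ) else 0)) =
      (if (K : ℤ) = (J : ℤ) - 1 then ((s ((J : ℤ) - 1) : ℝ) : ℂ) else 0) +
        (if (K : ℤ) = (J : ℤ) + 1 then -((s (J : ℤ) : ℝ) : ℂ) else 0) := by
  rw [map_add]
  congr 1
  · split_ifs <;> simp [Complex.conj_ofReal]
  · split_ifs <;> simp [Complex.conj_ofReal]

/-- **Real data stay real, integer-window form.** Three-term ladder on a finite window `W` with real links `s`, real
rates `d`, real coupling `g` (no gap, no smallness needed): if every `v_J(t₀)` is real then every `v_J(t)` is real on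
`[t₀, t₁]` (the transition matrix of a real linear system is real). [folklore]
[cite: KokotovicBensoussanBlankenship1987, Kokotović §2 (2.10)–(2.11), (2.19)–(2.20) (real coefficient and transition matrices)] -/
theorem real_intWindow (W : Finset ℤ) (d s : ℤ → ℝ) (Λ t₀ t₁ : ℝ) (g : ℝ → ℝ) (v : ℝ → ℤ → ℂ) (hΛ : 0 < Λ)
    (hsupp : ∀ t ∈ Icc t₀ t₁, ∀ J, J ∉ W → v t J = 0)
    (hderiv : ∀ t ∈ Icc t₀ t₁, ∀ J ∈ W, HasDerivWithinAt (fun τ => v τ J)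
        (-(Λ : ℂ) * ((d J : ℂ) * v t J) - (g t : ℂ) * (Λ : ℂ) * ((s (J - 1) : ℂ) * v t (J - 1) - (s J : ℂ) * v t (J + 1)))
        (Icc t₀ t₁) t)
    (hreal : ∀ J, conj (v t₀ J) = v t₀ J) :
    ∀ t ∈ Icc t₀ t₁, ∀ J, conj (v t J) = v t J := by
  classical
  set S : Matrix ↥W ↥W ℂ := fun J K => (if (K : ℤ) = (J : ℤ) - 1 then ((s ((J : ℤ) - 1) : ℝ) : ℂ) else 0) +
    (if (K : ℤ) = (J : ℤ) + 1 then -((s (J : ℤ) : ℝ) : ℂ) else 0) with hSdef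
  set V : ℝ → ↥W → ℂ := fun t J => v t J with hVdef
  set d' : ↥W → ℝ := fun J => d J with hd'
  have hS : ∀ J K, S K J = -conj (S J K) := fun J K => link_skew W s J K
  have hSreal : ∀ J K, conj (S J K) = S J K := fun J K => link_real W s J K
  have hcont : ContinuousOn V (Icc t₀ t₁) :=
    continuousOn_pi.2 fun J => fun t ht => (hderiv t ht J J.2).continuousWithinAt
  have hderiv' : ∀ t ∈ Ioo t₀ t₁, HasDerivAt V
      (fun J => -(Λ : ℂ) * ((d' J : ℂ) * V t J + (g t : ℂ) * ∑ K, S J K * V t K)) t := by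
    intro t ht
    have htI : t ∈ Icc t₀ t₁ := Ioo_subset_Icc_self ht
    rw [hasDerivAt_pi]
    intro J
    have h := (hderiv t htI J J.2).hasDerivAt (Icc_mem_nhds ht.1 ht.2)
    refine h.congr_deriv ?_
    simp only [hVdef, hSdef, hd']
    rw [sum_link_apply W s (hsupp t htI) (J : ℤ)]
    ring
  have key := conj_eq_of_conj_init S d' Λ t₀ t₁ g V hS hSreal hΛ hcont hderiv' (fun J => hreal J)
  intro t ht J
  by_cases hJ : J ∈ W
  · exact key t ht ⟨J, hJ⟩
  · rw [hsupp t ht J hJ, map_zero]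

/-- **The slot multiplier carries no phase.** Column datum `v_J(t₀) = 0` (`J ≠ 0`) with a real POSITIVE slow entry
`v_0(t₀)`, real links, gap and cone radius as in `cone_intWindow`: then `v_0(t) = ‖v_0(t)‖` (real, positive) on
`[t₀, t₁]`, so the slow entry of the column of the propagator IS the positive multiplier whose logarithm
`column_law_intWindow` controls — no phase bookkeeping in the composition over periods. [folklore]
[cite: KokotovicBensoussanBlankenship1987, Kokotović §2 (2.19)–(2.20), Thm 2.3] -/
theorem column_slow_eq_norm_intWindow (W : Finset ℤ) (h0 : (0 : ℤ) ∈ W) (h1 : (1 : ℤ) ∈ W) (hm1 : (-1 : ℤ) ∈ W)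
    (d s : ℤ → ℝ) (Λ gT Δ γ R t₀ t₁ : ℝ) (g : ℝ → ℝ) (v : ℝ → ℤ → ℂ)
    (hγ : γ ^ 2 = s 0 ^ 2 + s (-1) ^ 2) (hγ0 : 0 ≤ γ)
    (hΔ : ∀ J ∈ W, J ≠ 0 → d 0 + Δ ≤ d J) (hΛ : 0 < Λ)
    (hg : ∀ t ∈ Ioo t₀ t₁, |g t| ≤ gT) (hR : 0 < R) (htrap : gT * γ * (1 + R ^ 2) < Δ * R)
    (hsupp : ∀ t ∈ Icc t₀ t₁, ∀ J, J ∉ W → v t J = 0)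
    (hderiv : ∀ t ∈ Icc t₀ t₁, ∀ J ∈ W, HasDerivWithinAt (fun τ => v τ J)
        (-(Λ : ℂ) * ((d J : ℂ) * v t J) - (g t : ℂ) * (Λ : ℂ) * ((s (J - 1) : ℂ) * v t (J - 1) - (s J : ℂ) * v t (J + 1)))
        (Icc t₀ t₁) t)
    (hcol : ∀ J, J ≠ 0 → v t₀ J = 0) (hre : 0 < (v t₀ 0).re) (him : (v t₀ 0).im = 0) :
    ∀ t ∈ Icc t₀ t₁, v t 0 = ((‖v t 0‖ : ℝ) : ℂ) := by
  classical
  set o : ↥W := ⟨0, h0⟩ with ho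
  set S : Matrix ↥W ↥W ℂ := fun J K => (if (K : ℤ) = (J : ℤ) - 1 then ((s ((J : ℤ) - 1) : ℝ) : ℂ) else 0) +
    (if (K : ℤ) = (J : ℤ) + 1 then -((s (J : ℤ) : ℝ) : ℂ) else 0) with hSdef
  set V : ℝ → ↥W → ℂ := fun t J => v t J with hVdef
  set d' : ↥W → ℝ := fun J => d J with hd'
  have hS : ∀ J K, S K J = -conj (S J K) := fun J K => link_skew W s J K
  have hSreal : ∀ J K, conj (S J K) = S J K := fun J K => link_real W s J K
  have hγ' : γ ^ 2 = ∑ K ∈ univ.erase o, ‖S o K‖ ^ 2 := by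
    rw [hγ, ho]; exact (slowRow_norm_sq W h0 h1 hm1 s).symm
  have hΔ' : ∀ J : ↥W, J ≠ o → d' o + Δ ≤ d' J := fun J hJ =>
    hΔ J J.2 (fun h => hJ (Subtype.ext (by rw [ho]; exact h)))
  have hcont : ContinuousOn V (Icc t₀ t₁) :=
    continuousOn_pi.2 fun J => fun t ht => (hderiv t ht J J.2).continuousWithinAt
  have hderiv' : ∀ t ∈ Ioo t₀ t₁, HasDerivAt V
      (fun J => -(Λ : ℂ) * ((d' J : ℂ) * V t J + (g t : ℂ) * ∑ K, S J K * V t K)) t := by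
    intro t ht
    have htI : t ∈ Icc t₀ t₁ := Ioo_subset_Icc_self ht
    rw [hasDerivAt_pi]
    intro J
    have h := (hderiv t htI J J.2).hasDerivAt (Icc_mem_nhds ht.1 ht.2)
    refine h.congr_deriv ?_
    simp only [hVdef, hSdef, hd']
    rw [sum_link_apply W s (hsupp t htI) (J : ℤ)]
    ring
  have hv0 : v t₀ 0 ≠ 0 := fun h => by rw [h, Complex.zero_re] at hre; exact lt_irrefl _ hre
  have hreal' : ∀ J : ↥W, conj (V t₀ J) = V t₀ J := by
    intro J
    simp only [hVdef]
    by_cases hJ : (J : ℤ) = 0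
    · rw [hJ]; exact Complex.ext (by rw [Complex.conj_re]) (by rw [Complex.conj_im, him, neg_zero])
    · rw [hcol _ hJ, map_zero]
  have hpos' : 0 < (V t₀ o).re := by simp only [hVdef, ho]; exact hre
  have hinit' : ∑ J ∈ univ.erase o, ‖V t₀ J‖ ^ 2 < R ^ 2 * ‖V t₀ o‖ ^ 2 := by
    simp only [hVdef, ho]
    rw [sum_univ_erase_eq W h0 (fun J => ‖v t₀ J‖ ^ 2)]
    rw [Finset.sum_eq_zero (fun J hJ => by rw [hcol J (Finset.ne_of_mem_erase hJ), norm_zero, zero_pow two_ne_zero])]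
    exact mul_pos (pow_pos hR 2) (pow_pos (norm_pos_iff.2 hv0) 2)
  intro t ht
  have key := slow_eq_norm_of_real S d' o Λ gT Δ γ R t₀ t₁ g V hS hSreal hγ' hγ0 hΔ' hΛ hg hR htrap hcont hderiv'
    hreal' hpos' hinit' t ht
  simpa [hVdef, ho] using key

/-! ## §5 Linearity on an integer window: uniqueness, superposition, and the split of a general datum -/

/-- **Forward uniqueness, integer-window form** (any real `d`, `s`, `g`; `Λ > 0`): two solutions of the three-term
ladder on `[t₀, t₁]`, both vanishing off `W`, with the same datum at `t₀` coincide on `[t₀, t₁]`.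
[cite: KokotovicBensoussanBlankenship1987, Kokotović §2 (2.10)–(2.11)] [folklore] -/
theorem eq_of_eq_init_intWindow (W : Finset ℤ) (d s : ℤ → ℝ) (Λ t₀ t₁ : ℝ) (g : ℝ → ℝ) (v w : ℝ → ℤ → ℂ)
    (hΛ : 0 < Λ)
    (hvsupp : ∀ t ∈ Icc t₀ t₁, ∀ J, J ∉ W → v t J = 0)
    (hv : ∀ t ∈ Icc t₀ t₁, ∀ J ∈ W, HasDerivWithinAt (fun τ => v τ J)
        (-(Λ : ℂ) * ((d J : ℂ) * v t J) - (g t : ℂ) * (Λ : ℂ) * ((s (J - 1) : ℂ) * v t (J - 1) - (s J : ℂ) * v t (J + 1)))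
        (Icc t₀ t₁) t)
    (hwsupp : ∀ t ∈ Icc t₀ t₁, ∀ J, J ∉ W → w t J = 0)
    (hw : ∀ t ∈ Icc t₀ t₁, ∀ J ∈ W, HasDerivWithinAt (fun τ => w τ J)
        (-(Λ : ℂ) * ((d J : ℂ) * w t J) - (g t : ℂ) * (Λ : ℂ) * ((s (J - 1) : ℂ) * w t (J - 1) - (s J : ℂ) * w t (J + 1)))
        (Icc t₀ t₁) t)
    (hinit : ∀ J, v t₀ J = w t₀ J) : ∀ t ∈ Icc t₀ t₁, ∀ J, v t J = w t J := by
  classical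
  set S : Matrix ↥W ↥W ℂ := fun J K => (if (K : ℤ) = (J : ℤ) - 1 then ((s ((J : ℤ) - 1) : ℝ) : ℂ) else 0) +
    (if (K : ℤ) = (J : ℤ) + 1 then -((s (J : ℤ) : ℝ) : ℂ) else 0) with hSdef
  set V : ℝ → ↥W → ℂ := fun t J => v t J with hVdef
  set V' : ℝ → ↥W → ℂ := fun t J => w t J with hV'def
  set d' : ↥W → ℝ := fun J => d J with hd'
  have hS : ∀ J K, S K J = -conj (S J K) := fun J K => link_skew W s J K
  have hcont : ContinuousOn V (Icc t₀ t₁) :=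
    continuousOn_pi.2 fun J => fun t ht => (hv t ht J J.2).continuousWithinAt
  have hcont' : ContinuousOn V' (Icc t₀ t₁) :=
    continuousOn_pi.2 fun J => fun t ht => (hw t ht J J.2).continuousWithinAt
  have hderiv' : ∀ t ∈ Ioo t₀ t₁, HasDerivAt V
      (fun J => -(Λ : ℂ) * ((d' J : ℂ) * V t J + (g t : ℂ) * ∑ K, S J K * V t K)) t := by
    intro t ht
    have htI : t ∈ Icc t₀ t₁ := Ioo_subset_Icc_self ht
    rw [hasDerivAt_pi]
    intro J
    have h := (hv t htI J J.2).hasDerivAt (Icc_mem_nhds ht.1 ht.2)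
    refine h.congr_deriv ?_
    simp only [hVdef, hSdef, hd']
    rw [sum_link_apply W s (hvsupp t htI) (J : ℤ)]
    ring
  have hderiv'' : ∀ t ∈ Ioo t₀ t₁, HasDerivAt V'
      (fun J => -(Λ : ℂ) * ((d' J : ℂ) * V' t J + (g t : ℂ) * ∑ K, S J K * V' t K)) t := by
    intro t ht
    have htI : t ∈ Icc t₀ t₁ := Ioo_subset_Icc_self ht
    rw [hasDerivAt_pi]
    intro J
    have h := (hw t htI J J.2).hasDerivAt (Icc_mem_nhds ht.1 ht.2)
    refine h.congr_deriv ?_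
    simp only [hV'def, hSdef, hd']
    rw [sum_link_apply W s (hwsupp t htI) (J : ℤ)]
    ring
  have key := eq_of_eq_init S d' Λ t₀ t₁ g V V' hS hΛ hcont hcont' hderiv' hderiv''
    (funext fun J => hinit J)
  intro t ht J
  by_cases hJ : J ∈ W
  · exact congrFun (key t ht) ⟨J, hJ⟩
  · rw [hvsupp t ht J hJ, hwsupp t ht J hJ]

/-- **Superposition, integer-window form**: three solutions `v, v¹, v²` of the ladder on `[t₀, t₁]` (all vanishing
off `W`) with `v(t₀) = v¹(t₀) + v²(t₀)` satisfy `v = v¹ + v²` on `[t₀, t₁]` — split a datum into its slow COLUMN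
(`v¹(t₀) = v_0(t₀) e_0`: `cone_intWindow`, `column_law_intWindow`, `column_remainder_intWindow`,
`column_slow_eq_norm_intWindow`) and its FAST part (`v²_0(t₀) = 0`: `offCone_intWindow`). [folklore]
[cite: KokotovicBensoussanBlankenship1987, Kokotović §2 (2.19)–(2.20)] -/
theorem eq_add_intWindow (W : Finset ℤ) (d s : ℤ → ℝ) (Λ t₀ t₁ : ℝ) (g : ℝ → ℝ) (v v₁ v₂ : ℝ → ℤ → ℂ)
    (hΛ : 0 < Λ)
    (hvsupp : ∀ t ∈ Icc t₀ t₁, ∀ J, J ∉ W → v t J = 0)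
    (hv : ∀ t ∈ Icc t₀ t₁, ∀ J ∈ W, HasDerivWithinAt (fun τ => v τ J)
        (-(Λ : ℂ) * ((d J : ℂ) * v t J) - (g t : ℂ) * (Λ : ℂ) * ((s (J - 1) : ℂ) * v t (J - 1) - (s J : ℂ) * v t (J + 1)))
        (Icc t₀ t₁) t)
    (h1supp : ∀ t ∈ Icc t₀ t₁, ∀ J, J ∉ W → v₁ t J = 0)
    (h1 : ∀ t ∈ Icc t₀ t₁, ∀ J ∈ W, HasDerivWithinAt (fun τ => v₁ τ J)
        (-(Λ : ℂ) * ((d J : ℂ) * v₁ t J) - (g t : ℂ) * (Λ : ℂ) * ((s (J - 1) : ℂ) * v₁ t (J - 1) - (s J : ℂ) * v₁ t (J + 1)))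
        (Icc t₀ t₁) t)
    (h2supp : ∀ t ∈ Icc t₀ t₁, ∀ J, J ∉ W → v₂ t J = 0)
    (h2 : ∀ t ∈ Icc t₀ t₁, ∀ J ∈ W, HasDerivWithinAt (fun τ => v₂ τ J)
        (-(Λ : ℂ) * ((d J : ℂ) * v₂ t J) - (g t : ℂ) * (Λ : ℂ) * ((s (J - 1) : ℂ) * v₂ t (J - 1) - (s J : ℂ) * v₂ t (J + 1)))
        (Icc t₀ t₁) t)
    (hinit : ∀ J, v t₀ J = v₁ t₀ J + v₂ t₀ J) : ∀ t ∈ Icc t₀ t₁, ∀ J, v t J = v₁ t J + v₂ t J := by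
  set w : ℝ → ℤ → ℂ := fun t J => v₁ t J + v₂ t J with hw
  have hwsupp : ∀ t ∈ Icc t₀ t₁, ∀ J, J ∉ W → w t J = 0 := fun t ht J hJ => by
    simp only [hw, h1supp t ht J hJ, h2supp t ht J hJ, add_zero]
  have hwd : ∀ t ∈ Icc t₀ t₁, ∀ J ∈ W, HasDerivWithinAt (fun τ => w τ J)
      (-(Λ : ℂ) * ((d J : ℂ) * w t J) - (g t : ℂ) * (Λ : ℂ) * ((s (J - 1) : ℂ) * w t (J - 1) - (s J : ℂ) * w t (J + 1)))
      (Icc t₀ t₁) t := by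
    intro t ht J hJ
    refine ((h1 t ht J hJ).add (h2 t ht J hJ)).congr_deriv ?_
    simp only [hw]
    ring
  exact eq_of_eq_init_intWindow W d s Λ t₀ t₁ g v w hΛ hvsupp hv hwsupp hwd hinit

/-- **The split of a general datum (slot map: slow feed and fast relaxation of the fast part).** Ladder on
`W ∋ 0, ±1`, gap `Δ > 0` off `0`, `d 0 ≥ 0`, `|g| ≤ g_T`, `γ² = s 0² + s(−1)²`. Let `v` be a solution and `v¹` the
solution from its COLUMN datum (`v¹_0(t₀) = v_0(t₀)`, `v¹_J(t₀) = 0` otherwise). Then, with `Z₀ = Σ_{J≠0}‖v_J(t₀)‖²`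
and `x' = Λ(g_Tγ)²/Δ`, on `[t₀, t₁]`: `‖v_0(t) − v¹_0(t)‖ ≤ (g_Tγ/Δ) e^{x'(t−t₀)} √Z₀` (the fast part feeds the slow
mode by at most `g_Tγ/Δ`) and `√(Σ_{J≠0}‖v_J(t) − v¹_J(t)‖²) ≤ (e^{−ΛΔ(t−t₀)} + (g_Tγ/Δ)² e^{x'(t−t₀)}) √Z₀` (it relaxes
at the gap rate) — `offCone_intWindow` for the difference `v − v¹`, a solution with vanishing slow datum.
[cite: KokotovicBensoussanBlankenship1987, Kokotović §2 (2.16)–(2.20), Thm 2.3] -/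
theorem split_intWindow (W : Finset ℤ) (h0 : (0 : ℤ) ∈ W) (h1 : (1 : ℤ) ∈ W) (hm1 : (-1 : ℤ) ∈ W)
    (d s : ℤ → ℝ) (Λ gT Δ γ t₀ t₁ : ℝ) (g : ℝ → ℝ) (v v₁ : ℝ → ℤ → ℂ)
    (hγ : γ ^ 2 = s 0 ^ 2 + s (-1) ^ 2) (hγ0 : 0 ≤ γ)
    (hΔ : ∀ J ∈ W, J ≠ 0 → d 0 + Δ ≤ d J) (hΔ0 : 0 < Δ) (hd0 : 0 ≤ d 0) (hΛ : 0 < Λ)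
    (hg : ∀ t ∈ Ioo t₀ t₁, |g t| ≤ gT) (hgT : 0 ≤ gT)
    (hvsupp : ∀ t ∈ Icc t₀ t₁, ∀ J, J ∉ W → v t J = 0)
    (hv : ∀ t ∈ Icc t₀ t₁, ∀ J ∈ W, HasDerivWithinAt (fun τ => v τ J)
        (-(Λ : ℂ) * ((d J : ℂ) * v t J) - (g t : ℂ) * (Λ : ℂ) * ((s (J - 1) : ℂ) * v t (J - 1) - (s J : ℂ) * v t (J + 1)))
        (Icc t₀ t₁) t)
    (h1supp : ∀ t ∈ Icc t₀ t₁, ∀ J, J ∉ W → v₁ t J = 0)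
    (hv₁ : ∀ t ∈ Icc t₀ t₁, ∀ J ∈ W, HasDerivWithinAt (fun τ => v₁ τ J)
        (-(Λ : ℂ) * ((d J : ℂ) * v₁ t J) - (g t : ℂ) * (Λ : ℂ) * ((s (J - 1) : ℂ) * v₁ t (J - 1) - (s J : ℂ) * v₁ t (J + 1)))
        (Icc t₀ t₁) t)
    (hcol0 : v₁ t₀ 0 = v t₀ 0) (hcol : ∀ J, J ≠ 0 → v₁ t₀ J = 0) :
    ∀ t ∈ Icc t₀ t₁,
      ‖v t 0 - v₁ t 0‖ ≤ gT * γ / Δ * Real.exp (Λ * (gT * γ) ^ 2 / Δ * (t - t₀)) *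
          Real.sqrt (∑ J ∈ W.erase 0, ‖v t₀ J‖ ^ 2) ∧
      Real.sqrt (∑ J ∈ W.erase 0, ‖v t J - v₁ t J‖ ^ 2) ≤
        (Real.exp (-(Λ * Δ) * (t - t₀)) + (gT * γ / Δ) ^ 2 * Real.exp (Λ * (gT * γ) ^ 2 / Δ * (t - t₀))) *
          Real.sqrt (∑ J ∈ W.erase 0, ‖v t₀ J‖ ^ 2) := by
  -- the difference `u = v − v¹` is a solution with `u_0(t₀) = 0`, `u_J(t₀) = v_J(t₀)` (`J ≠ 0`)
  set u : ℝ → ℤ → ℂ := fun t J => v t J - v₁ t J with hu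
  have husupp : ∀ t ∈ Icc t₀ t₁, ∀ J, J ∉ W → u t J = 0 := fun t ht J hJ => by
    simp only [hu, hvsupp t ht J hJ, h1supp t ht J hJ, sub_zero]
  have hud : ∀ t ∈ Icc t₀ t₁, ∀ J ∈ W, HasDerivWithinAt (fun τ => u τ J)
      (-(Λ : ℂ) * ((d J : ℂ) * u t J) - (g t : ℂ) * (Λ : ℂ) * ((s (J - 1) : ℂ) * u t (J - 1) - (s J : ℂ) * u t (J + 1)))
      (Icc t₀ t₁) t := by
    intro t ht J hJ
    refine ((hv t ht J hJ).sub (hv₁ t ht J hJ)).congr_deriv ?_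
    simp only [hu]
    ring
  have hu0 : ‖u t₀ 0‖ = 0 := by simp only [hu, hcol0, sub_self, norm_zero]
  have huZ : ∑ J ∈ W.erase 0, ‖u t₀ J‖ ^ 2 = ∑ J ∈ W.erase 0, ‖v t₀ J‖ ^ 2 :=
    Finset.sum_congr rfl fun J hJ => by simp only [hu, hcol J (Finset.ne_of_mem_erase hJ), sub_zero]
  intro t ht
  have key := offCone_intWindow W h0 h1 hm1 d s Λ gT Δ γ t₀ t₁ g u hγ hγ0 hΔ hΔ0 hd0 hΛ hg hgT husupp hud t ht
  rw [hu0, huZ, zero_add] at key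
  obtain ⟨k1, k2⟩ := key
  refine ⟨?_, ?_⟩
  · calc ‖v t 0 - v₁ t 0‖ = ‖u t 0‖ := by simp only [hu]
      _ ≤ _ := k1
      _ = _ := by ring
  · calc Real.sqrt (∑ J ∈ W.erase 0, ‖v t J - v₁ t J‖ ^ 2) = Real.sqrt (∑ J ∈ W.erase 0, ‖u t J‖ ^ 2) := by
          simp only [hu]
      _ ≤ _ := k2
      _ = _ := by ring

/-! ## §6 Scaling and the phase of the slot multiplier for a complex slow datum -/

/-- Scalar multiples of solutions are solutions. [folklore] -/
private theorem smul_solution (W : Finset ℤ) (d s : ℤ → ℝ) (Λ t₀ t₁ : ℝ) (g : ℝ → ℝ) (u : ℝ → ℤ → ℂ) (β : ℂ)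
    (hu : ∀ t ∈ Icc t₀ t₁, ∀ J ∈ W, HasDerivWithinAt (fun τ => u τ J)
        (-(Λ : ℂ) * ((d J : ℂ) * u t J) - (g t : ℂ) * (Λ : ℂ) * ((s (J - 1) : ℂ) * u t (J - 1) - (s J : ℂ) * u t (J + 1)))
        (Icc t₀ t₁) t) :
    ∀ t ∈ Icc t₀ t₁, ∀ J ∈ W, HasDerivWithinAt (fun τ => β * u τ J)
        (-(Λ : ℂ) * ((d J : ℂ) * (β * u t J)) -
          (g t : ℂ) * (Λ : ℂ) * ((s (J - 1) : ℂ) * (β * u t (J - 1)) - (s J : ℂ) * (β * u t (J + 1))))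
        (Icc t₀ t₁) t := by
  intro t ht J hJ
  refine ((hu t ht J hJ).const_mul β).congr_deriv ?_
  ring

/-- **Scaling, integer-window form**: if `u` and `v` solve the ladder on `[t₀, t₁]` (both vanishing off `W`) and
`v(t₀) = β u(t₀)` then `v = β u` on `[t₀, t₁]`. [folklore]
[cite: KokotovicBensoussanBlankenship1987, Kokotović §2 (2.10)–(2.11)] -/
theorem eq_smul_intWindow (W : Finset ℤ) (d s : ℤ → ℝ) (Λ t₀ t₁ : ℝ) (g : ℝ → ℝ) (v u : ℝ → ℤ → ℂ) (β : ℂ)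
    (hΛ : 0 < Λ)
    (hvsupp : ∀ t ∈ Icc t₀ t₁, ∀ J, J ∉ W → v t J = 0)
    (hv : ∀ t ∈ Icc t₀ t₁, ∀ J ∈ W, HasDerivWithinAt (fun τ => v τ J)
        (-(Λ : ℂ) * ((d J : ℂ) * v t J) - (g t : ℂ) * (Λ : ℂ) * ((s (J - 1) : ℂ) * v t (J - 1) - (s J : ℂ) * v t (J + 1)))
        (Icc t₀ t₁) t)
    (husupp : ∀ t ∈ Icc t₀ t₁, ∀ J, J ∉ W → u t J = 0)
    (hu : ∀ t ∈ Icc t₀ t₁, ∀ J ∈ W, HasDerivWithinAt (fun τ => u τ J)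
        (-(Λ : ℂ) * ((d J : ℂ) * u t J) - (g t : ℂ) * (Λ : ℂ) * ((s (J - 1) : ℂ) * u t (J - 1) - (s J : ℂ) * u t (J + 1)))
        (Icc t₀ t₁) t)
    (hinit : ∀ J, v t₀ J = β * u t₀ J) : ∀ t ∈ Icc t₀ t₁, ∀ J, v t J = β * u t J :=
  eq_of_eq_init_intWindow W d s Λ t₀ t₁ g v (fun t J => β * u t J) hΛ hvsupp hv
    (fun t ht J hJ => by simp only [husupp t ht J hJ, mul_zero]) (smul_solution W d s Λ t₀ t₁ g u β hu) hinit

/-- **The slot multiplier carries no phase — general complex slow datum.** Column datum `v_J(t₀) = 0` (`J ≠ 0`) with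
ANY `v_0(t₀) ≠ 0`, real links, gap and cone radius as in `cone_intWindow`: on `[t₀, t₁]`,
`v_0(t) = (‖v_0(t)‖/‖v_0(t₀)‖)·v_0(t₀)` — the slow entry is its datum times a POSITIVE REAL multiplier (apply
`column_slow_eq_norm_intWindow` to the rotated solution `(conj v_0(t₀)/‖v_0(t₀)‖)·v`). [folklore]
[cite: KokotovicBensoussanBlankenship1987, Kokotović §2 (2.19)–(2.20), Thm 2.3] -/
theorem column_slow_phase_intWindow (W : Finset ℤ) (h0 : (0 : ℤ) ∈ W) (h1 : (1 : ℤ) ∈ W) (hm1 : (-1 : ℤ) ∈ W)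
    (d s : ℤ → ℝ) (Λ gT Δ γ R t₀ t₁ : ℝ) (g : ℝ → ℝ) (v : ℝ → ℤ → ℂ)
    (hγ : γ ^ 2 = s 0 ^ 2 + s (-1) ^ 2) (hγ0 : 0 ≤ γ)
    (hΔ : ∀ J ∈ W, J ≠ 0 → d 0 + Δ ≤ d J) (hΛ : 0 < Λ)
    (hg : ∀ t ∈ Ioo t₀ t₁, |g t| ≤ gT) (hR : 0 < R) (htrap : gT * γ * (1 + R ^ 2) < Δ * R)
    (hsupp : ∀ t ∈ Icc t₀ t₁, ∀ J, J ∉ W → v t J = 0)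
    (hderiv : ∀ t ∈ Icc t₀ t₁, ∀ J ∈ W, HasDerivWithinAt (fun τ => v τ J)
        (-(Λ : ℂ) * ((d J : ℂ) * v t J) - (g t : ℂ) * (Λ : ℂ) * ((s (J - 1) : ℂ) * v t (J - 1) - (s J : ℂ) * v t (J + 1)))
        (Icc t₀ t₁) t)
    (hcol : ∀ J, J ≠ 0 → v t₀ J = 0) (hv0 : v t₀ 0 ≠ 0) :
    ∀ t ∈ Icc t₀ t₁, v t 0 = ((‖v t 0‖ / ‖v t₀ 0‖ : ℝ) : ℂ) * v t₀ 0 := by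
  -- rotate the datum to the positive real axis
  have hn0 : 0 < ‖v t₀ 0‖ := norm_pos_iff.2 hv0
  have hn0' : ((‖v t₀ 0‖ : ℝ) : ℂ) ≠ 0 := by exact_mod_cast hn0.ne'
  set β : ℂ := conj (v t₀ 0) / ((‖v t₀ 0‖ : ℝ) : ℂ) with hβ
  set u : ℝ → ℤ → ℂ := fun t J => β * v t J with hudef
  have husupp : ∀ t ∈ Icc t₀ t₁, ∀ J, J ∉ W → u t J = 0 := fun t ht J hJ => by
    simp only [hudef, hsupp t ht J hJ, mul_zero]
  have hu := smul_solution W d s Λ t₀ t₁ g v β hderiv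
  have hucol : ∀ J, J ≠ 0 → u t₀ J = 0 := fun J hJ => by simp only [hudef, hcol J hJ, mul_zero]
  have hu0 : u t₀ 0 = ((‖v t₀ 0‖ : ℝ) : ℂ) := by
    simp only [hudef, hβ]
    rw [div_mul_eq_mul_div, Complex.conj_mul' (v t₀ 0)]   -- conj z * z = ‖z‖^2
    rw [sq, mul_div_assoc, div_self hn0', mul_one]
  have hure : 0 < (u t₀ 0).re := by rw [hu0, Complex.ofReal_re]; exact hn0
  have huim : (u t₀ 0).im = 0 := by rw [hu0, Complex.ofReal_im]
  have key := column_slow_eq_norm_intWindow W h0 h1 hm1 d s Λ gT Δ γ R t₀ t₁ g u hγ hγ0 hΔ hΛ hg hR htrap husupp hu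
    hucol hure huim
  -- undo the rotation: `v = conj β⁻¹… `; `‖u t 0‖ = ‖v t 0‖`
  have hβn : ‖β‖ = 1 := by
    rw [hβ, norm_div, Complex.norm_conj, Complex.norm_real, Real.norm_eq_abs, abs_of_pos hn0, div_self hn0.ne']
  have hβ0 : β ≠ 0 := fun h => by rw [h, norm_zero] at hβn; exact zero_ne_one hβn
  have hβinv : β⁻¹ = v t₀ 0 / ((‖v t₀ 0‖ : ℝ) : ℂ) := by
    rw [Complex.inv_def, Complex.normSq_eq_norm_sq, hβn, one_pow, inv_one, Complex.ofReal_one, mul_one, hβ, map_div₀,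
      Complex.conj_conj, Complex.conj_ofReal]
  intro t ht
  have h := key t ht
  simp only [hudef] at h
  rw [norm_mul, hβn, one_mul] at h
  -- `β * v t 0 = ‖v t 0‖` ⇒ `v t 0 = β⁻¹ * ‖v t 0‖`
  have h' : v t 0 = β⁻¹ * ((‖v t 0‖ : ℝ) : ℂ) := by
    rw [eq_inv_mul_iff_mul_eq₀ hβ0]; exact h
  calc v t 0 = β⁻¹ * ((‖v t 0‖ : ℝ) : ℂ) := h'
    _ = ((‖v t 0‖ / ‖v t₀ 0‖ : ℝ) : ℂ) * v t₀ 0 := by rw [hβinv, Complex.ofReal_div]; ring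

end IntWindowLadder

end Literature.Analysis.ODE
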